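import Summits.QuantumFields.BalabanUV.T4Continuum.Support.NE9SizeFedCouplingSpeciesReadOutOn
import Summits.QuantumFields.BalabanUV.T4Continuum.Support.NE9TableReading
import Summits.QuantumFields.BalabanUV.T4Continuum.Support.NE9RecursionFunctional

/-!
# NE9EndApplied — THE END OF RECORD (re-cut, `…_fedA3_on`) APPLIED TO THE RECURSION-DEFINED FUNCTIONAL WITH THE CONCRETE TABLE
# READING: `EfOf := recE base (compProj 𝒯 (margProj r A)) ΨOf`, `ρ := NE9TableReading.readingρ wt`, `𝒜 := admOf` (readings of
# the ARISING box tables) — the five structure binders S1 `h0`, S4 `hfac`∕`hreprV`, R1 `hρ`, R2-box `hboxOn` DISCHARGED BY CONSTRUCTION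
# (cell `pub-balaban`, T4-DAG §2 node U3 ∕ §6 NE9; BINDER row NE9 OWNER lineage `b2b-balaban-t4-ne9-p1`, generation 32;
# sheet `t4/b2b-balaban-t4-ne9-p1/g32/TABLE-HALF-NE9-g32.md` §1 «the design», kernel capstone)

HONEST FRAMING (T4-DAG PAGE 1).  Rung (B)+1 of the FINITE-VOLUME T⁴ programme — NOT infinite volume, NOT a mass gap, NOT the
Clay problem.  NE9 (`T4OutputRate.NE9` ∧ `FadingMemory`) is a cell NEW ESTIMATE, NOT PRINTED in [I] = [Balaban1987RG1]
(CMP **109**), [II] = [Balaban1988RG2Cluster] (CMP **116**), and NOT PROVED for Bałaban's E^{(j)} («NE9 ⇐ the named binders»;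
0∕18 leaves instantiated on Bałaban's objects; spine PROVED 0∕9).  HONEST DEPENDENCY (cell line, verbatim): continuum YM on T⁴ ⇐
BetaPertH ∧ nine spine estimates (0/9 proved); BetaPertH ⇐ (D1) ∧ (D4) ∧ CAP+tail; G-an2-4 gates asym, D1 and NE2/3/4.
`FlowStep.BetaPertH`, (B), (B^μ) do not occur.  Three data definitions (`ΨOf`, `EfOf`, `admOf`), no `def … : Prop`, no estimate
of any object of the series; quotations for TYPES only (ABSOLUTE RULE).  0 sorry.

WHAT.  The END of record takes an ABSTRACT functional `Ef` with five structure binders that say «`Ef` IS the recursion (2.13) fed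
through the channel, read by `ρ` into the activities» — S1 `h0 : ScaleZeroFree`, S4 `hfac : Factorises Ef W (compProj 𝒯 P) Ψ` +
`hreprV` (the vacuum-subtracted representation of `Ψ`), R1 `hρ` (reading 1-Lipschitz), R2-box `hboxOn` (arising box tables read
into `𝒜 k`).  THIS FILE DEFINES the functional and the reading and PROVES the five:
* §1 `margProj_truncScale` (the read-out projection commutes with truncation, `ReadZero`), **`channelLocal_compProj_margProj`**
  (`ChannelLocal MF 𝒯` + `ProjInto Adm MF (margProj r A)` + `ReadZero r` ⇒ `ChannelLocal Adm (compProj 𝒯 (margProj r A))`);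
* §2 DATA **`ΨOf G act wt U₀ explZ`** `k s Q U X := Re newTerm act k s U X (readingρ wt k Q) − Re newTerm act k s U₀ X (readingρ wt k Q)
  + explZ k U X` ([I] (2.13)–(2.14) p. 268 with the subtraction at the vacuum point `U₀`), **`EfOf … base 𝒯 P := recE base (compProj 𝒯 P)
  (ΨOf …)`** (t4-ne9-p2's `NE9RecursionFunctional.recE`, [I] (0.23) p. 256), **`admOf … W S k`** := the readings of the ARISING box
  tables `{readingρ wt k (compProj 𝒯 P k g′ (EfOf … g)) | g, g′ ∈ W, box bound of radius S k}`; `EfOf_zero`, **`factorises_EfOf`**;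
* §3 **`termSize_ne9_and_fadingMemory_endApplied`** — `NE9SizeFedCouplingSpeciesReadOutOn.…_fedA3_on` at `Pot := lp (fun _ : ι => ℂ) ∞`,
  `ρ := readingρ wt` (`wt :=` the END's `weightOf …`), `Ef := EfOf …`, `Ψ := ΨOf …`, `𝒜 := admOf … W (sizeRadius …)`: hypothesis list
  = the END of record's (WALL-NE9-P1 §2) MINUS `h0 ∕ hfac ∕ hreprV ∕ hρ ∕ hboxOn` (proved: `scaleZeroFree_recE`, `factorises_EfOf`, `rfl`,
  `NE9TableReading.hρ_reading`, definition of `admOf`), with `hbase` stated on the scale-0 datum `base` and ONE scalar added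
  (`hwt : 0 < weightOf …`, for the reading); `hAdm`, `hCup`, `hKP` are now statements about the DEFINED functional and the readings
  of ITS arising tables.  Conclusion LITERALLY `TermSize (EfOf …) W κ N ∧ NE9 (EfOf …) W κ Λ ∧ FadingMemory (ℓ∕ω′) ω′ Λ` with the END
  of record's letters.
WHAT REMAINS DISPLAYED (unchanged classes, WALL §2): species data + `Admissible` (S5, T), counts, MF∕`hAdm` (T: terms analytic —
now about `EfOf`, i.e. about the activities' analyticity in the background), A1 `hKP` ∕ A2 `hCup` ON `admOf` (T: (B)'s interior
(R-1) at potentials of Bałaban's type only), A3, G1∕G2, N1∕N2, RO∕AW, `hexplZ`, `hbase0`.  The instancer's remaining M-items: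
`act := actChart … iRecC` on the substrate's chart (p221235) with `iRecC` into `B13HistM` (row REG), the species DATA on the carriers
of record, then this theorem per background + the real row (p220529).  DISGUISE TEST: the END applied to a defined functional; no
new estimate; not NE9 for Bałaban's E^{(j)} (O-NE9-1).

References (TYPES only): [Balaban1987RG1] T. Bałaban, CMP **109** (1987) 249–301, (0.23) p. 256, (1.3) p. 260, (1.18) p. 263,
(1.20)–(1.22) p. 264, (2.13)–(2.14) p. 268; [Balaban1988RG2Cluster] T. Bałaban, CMP **116** (1988) 1–22, (1.33)–(1.36) p. 9,
(2.14)–(2.15) p. 15.  Summits-side NEW work (LEAN PLACEMENT RULE); imports the re-cut END (p223403), `NE9TableReading` (p223302),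
`NE9RecursionFunctional` (t4-ne9-p2) BY NAME; modifies nothing.
-/

noncomputable section

namespace Summit.QuantumFields.BalabanUV.T4Continuum.NE9EndApplied

open scoped BigOperators ENNReal
open Metric Set
open Literature.Probability.LatticeModels
open Literature.MathematicalPhysics.QuantumFieldTheory.Balaban1983to89
open Literature.MathematicalPhysics.QuantumFieldTheory.Balaban1983to89.T4OutputRate
open Literature.MathematicalPhysics.QuantumFieldTheory.Balaban1983to89.T4HistoryLipschitzRecursion
open Literature.MathematicalPhysics.QuantumFieldTheory.Balaban1983to89.T4HistoryLipschitzOuter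
open Literature.MathematicalPhysics.QuantumFieldTheory.Balaban1983to89.T4HistoryLipschitzActivity
open Literature.MathematicalPhysics.QuantumFieldTheory.Balaban1983to89.T4HistoryLipschitzActivity (ClusterGeom)
open Literature.MathematicalPhysics.QuantumFieldTheory.Balaban1983to89.T4HistoryLipschitzSegment
open Summit.QuantumFields.BalabanUV.T4Continuum.NE9Lemma1Counting
open Summit.QuantumFields.BalabanUV.T4Continuum.NE9Lemma1Gain
open Summit.QuantumFields.BalabanUV.T4Continuum.NE9Lemma1PieceClass
open Summit.QuantumFields.BalabanUV.T4Continuum.NE9Lemma1RemainderSpecies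
open Summit.QuantumFields.BalabanUV.T4Continuum.NE9Lemma1CurveSpecies
open Summit.QuantumFields.BalabanUV.T4Continuum.NE9Lemma1KernelSpecies
open Summit.QuantumFields.BalabanUV.T4Continuum.NE9Lemma1RemainderSpeciesEnd (channelSizeAtStepNN_mono pieceAdditiveOn_mono)
open Summit.QuantumFields.BalabanUV.T4Continuum.NE9Lemma1SpeciesEnd (profile_species)
open Summit.QuantumFields.BalabanUV.T4Continuum.NE9ComplexEncoding (doubleCarriers)
open Summit.QuantumFields.BalabanUV.T4Continuum.NE9MarginalProjection
open Summit.QuantumFields.BalabanUV.T4Continuum.NE9MarginalProjectionEnd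
open Summit.QuantumFields.BalabanUV.T4Continuum.NE9ChannelSum
open Summit.QuantumFields.BalabanUV.T4Continuum.NE9SizeFedCoupling
open Summit.QuantumFields.BalabanUV.T4Continuum.NE9SizeFedCouplingSpecies (tcup_species_proj)

open Summit.QuantumFields.BalabanUV.T4Continuum.NE9SizeFedCouplingSpeciesReadOutOn
open Summit.QuantumFields.BalabanUV.T4Continuum.NE9TableReading
open Summit.QuantumFields.BalabanUV.T4Continuum.NE9RecursionFunctional

/-! ## §1 The read-out projection commutes with truncation; locality of the projected channel -/

section Proj

variable {C : Carriers} {Bg ι : Type}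

/-- [folklore] restriction to a creation step `j ≤ k` does not see the truncation at `k`. -/
theorem restrictScale_truncScale_of_le {j k : ℕ} (hjk : j ≤ k) (H : Bg → C.Dom → ℝ) :
    restrictScale j (truncScale k H) = restrictScale j H := by
  funext U X
  simp only [restrictScale, truncScale]
  by_cases h : C.scale X = j
  · rw [if_pos h, if_pos h, if_pos (h ▸ hjk)]
  · rw [if_neg h, if_neg h]

/-- [folklore] restriction to a creation step `j > k` of the truncation at `k` vanishes. -/
theorem restrictScale_truncScale_of_lt {j k : ℕ} (hkj : k < j) (H : Bg → C.Dom → ℝ) :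
    restrictScale j (truncScale k H) = 0 := by
  funext U X
  simp only [restrictScale, truncScale, Pi.zero_apply]
  by_cases h : C.scale X = j
  · rw [if_pos h, if_neg (by omega)]
  · rw [if_neg h]

/-- [folklore] **THE READ-OUT PROJECTION COMMUTES WITH TRUNCATION** (`ReadZero r`): `margProj r A (truncScale k H) = truncScale k
(margProj r A H)` — the projection reads each domain's own creation-step slice only ([I] (1.3) p. 260: one counterterm per step).
[cite: Balaban1987RG1, (1.3) p.260 and (1.20)-(1.22) p.264] -/
theorem margProj_truncScale {r : ℕ → (Bg → C.Dom → ℝ) → ℝ} (hr0 : ReadZero r) (A : Bg → C.Dom → ℝ) (k : ℕ)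
    (H : Bg → C.Dom → ℝ) : margProj r A (truncScale k H) = truncScale k (margProj r A H) := by
  funext U X
  simp only [margProj, truncScale]
  by_cases h : C.scale X ≤ k
  · rw [if_pos h, if_pos h, restrictScale_truncScale_of_le h]
  · rw [if_neg h, if_neg h, restrictScale_truncScale_of_lt (lt_of_not_ge h), hr0, zero_mul, sub_zero]

/-- [folklore] **LOCALITY OF THE PROJECTED CHANNEL**: `ChannelLocal MF 𝒯`, `ProjInto Adm MF (margProj r A)` and `ReadZero r` give
`ChannelLocal Adm (compProj 𝒯 (margProj r A))` — the binder `NE9RecursionFunctional.factorises_recE_of_channelLocal` consumes.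
[cite: Balaban1988RG2Cluster, (1.33) p.9] -/
theorem channelLocal_compProj_margProj {Adm MF : Set (Bg → C.Dom → ℝ)} {r : ℕ → (Bg → C.Dom → ℝ) → ℝ}
    {A : Bg → C.Dom → ℝ} {𝒯 : ℕ → (ℕ → ℝ) → (Bg → C.Dom → ℝ) → ι → ℝ} (hr0 : ReadZero r)
    (hPinto : ProjInto Adm MF (margProj r A)) (hloc : ChannelLocal MF 𝒯) :
    ChannelLocal Adm (compProj 𝒯 (margProj r A)) := by
  intro k s H hH y
  simp only [compProj]
  rw [hloc k s _ (hPinto H hH) y, margProj_truncScale hr0]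

end Proj

/-! ## §2 The defined functional, its new-term map and the admissible set of readings of arising tables -/

section Species

variable {C₀ : Carriers} {E : Type} [NormedAddCommGroup E] [NormedSpace ℂ E]
  {ι α β γ δ α' β' γ' δ' Pt : Type} [DecidableEq δ] [DecidableEq δ']

/-- [folklore] DATA: **THE NEW-TERM MAP OF RECORD WITH THE CONCRETE READING** — `Re` of the cluster sum at the background minus
its value at the vacuum point `U₀` plus the coupling-free explicit part, the table read by `readingρ wt k`.
[cite: Balaban1987RG1, (2.13)-(2.14) p.268] -/
def ΨOf (G : ClusterGeom (doubleCarriers C₀)) (act : ℕ → ℝ → E → lp (fun _ : ι => ℂ) ∞ → G.P → ℂ) (wt : ℕ → ι → ℝ)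
    (U₀ : E) (explZ : ℕ → E → (doubleCarriers C₀).Dom → ℝ) : ℕ → ℝ → (ι → ℝ) → E → (doubleCarriers C₀).Dom → ℝ :=
  fun k s Q U X => (G.newTerm act k s U X (readingρ wt k Q)).re - (G.newTerm act k s U₀ X (readingρ wt k Q)).re + explZ k U X

/-- [folklore] DATA: **THE RECURSION-DEFINED FUNCTIONAL OF RECORD** — `recE base (compProj 𝒯 P) (ΨOf …)`: scale-0 datum `base`,
channel `𝒯` fed with the projected old terms, new term `ΨOf`. [cite: Balaban1987RG1, (0.23) p.256 and (2.13) p.268] -/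
def EfOf (G : ClusterGeom (doubleCarriers C₀)) (act : ℕ → ℝ → E → lp (fun _ : ι => ℂ) ∞ → G.P → ℂ) (wt : ℕ → ι → ℝ)
    (U₀ : E) (explZ : ℕ → E → (doubleCarriers C₀).Dom → ℝ) (base : E → (doubleCarriers C₀).Dom → ℝ)
    (𝒯 : ℕ → (ℕ → ℝ) → (E → (doubleCarriers C₀).Dom → ℝ) → ι → ℝ)
    (P : (E → (doubleCarriers C₀).Dom → ℝ) → (E → (doubleCarriers C₀).Dom → ℝ)) : Functional (doubleCarriers C₀) E :=
  recE base (compProj 𝒯 P) (ΨOf G act wt U₀ explZ)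

/-- [folklore] DATA: **THE ADMISSIBLE CONFIGURATIONS = READINGS OF THE ARISING BOX TABLES** of the defined functional: at step `k`,
`{readingρ wt k (compProj 𝒯 P k g′ (EfOf … g)) | g, g′ ∈ W, ∀ y, |compProj 𝒯 P k g′ (EfOf … g) y| ≤ wt k y · S k}`. -/
def admOf (G : ClusterGeom (doubleCarriers C₀)) (act : ℕ → ℝ → E → lp (fun _ : ι => ℂ) ∞ → G.P → ℂ) (wt : ℕ → ι → ℝ)
    (U₀ : E) (explZ : ℕ → E → (doubleCarriers C₀).Dom → ℝ) (base : E → (doubleCarriers C₀).Dom → ℝ)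
    (𝒯 : ℕ → (ℕ → ℝ) → (E → (doubleCarriers C₀).Dom → ℝ) → ι → ℝ)
    (P : (E → (doubleCarriers C₀).Dom → ℝ) → (E → (doubleCarriers C₀).Dom → ℝ)) (W : Set (ℕ → ℝ)) (S : ℕ → ℝ) (k : ℕ) :
    Set (lp (fun _ : ι => ℂ) ∞) :=
  {Q' | ∃ g ∈ W, ∃ g' ∈ W, (∀ y, |compProj 𝒯 P k g' (EfOf G act wt U₀ explZ base 𝒯 P g) y| ≤ wt k y * S k) ∧
    Q' = readingρ wt k (compProj 𝒯 P k g' (EfOf G act wt U₀ explZ base 𝒯 P g))}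

section Defs

variable (G : ClusterGeom (doubleCarriers C₀)) (act : ℕ → ℝ → E → lp (fun _ : ι => ℂ) ∞ → G.P → ℂ) (wt : ℕ → ι → ℝ)
  (U₀ : E) (explZ : ℕ → E → (doubleCarriers C₀).Dom → ℝ) (base : E → (doubleCarriers C₀).Dom → ℝ)
  {𝒯 : ℕ → (ℕ → ℝ) → (E → (doubleCarriers C₀).Dom → ℝ) → ι → ℝ}
  {P : (E → (doubleCarriers C₀).Dom → ℝ) → (E → (doubleCarriers C₀).Dom → ℝ)}

omit [NormedAddCommGroup E] [NormedSpace ℂ E] in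
/-- [folklore] On creation step 0 the defined functional is the scale-0 datum. -/
theorem EfOf_zero (g : ℕ → ℝ) {U : E} {X : (doubleCarriers C₀).Dom} (hX : (doubleCarriers C₀).scale X = 0) :
    EfOf G act wt U₀ explZ base 𝒯 P g U X = base U X :=
  recE_zero g hX

omit [NormedAddCommGroup E] [NormedSpace ℂ E] in
/-- [folklore] **`Factorises` FOR THE DEFINED FUNCTIONAL** from locality of the projected channel on the admissible class and
admissibility of the window's families (`NE9RecursionFunctional.factorises_recE_of_channelLocal`). [cite: Balaban1988RG2Cluster, (1.33) p.9] -/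
theorem factorises_EfOf {W : Set (ℕ → ℝ)} {Adm : Set (E → (doubleCarriers C₀).Dom → ℝ)} (hloc : ChannelLocal Adm (compProj 𝒯 P))
    (hAdm : ∀ g ∈ W, EfOf G act wt U₀ explZ base 𝒯 P g ∈ Adm) :
    Factorises (EfOf G act wt U₀ explZ base 𝒯 P) W (compProj 𝒯 P) (ΨOf G act wt U₀ explZ) :=
  factorises_recE_of_channelLocal hloc hAdm

end Defs

/-! ## §3 The END of record applied -/

/-- **THE END OF RECORD (`…_fedA3_on`) APPLIED TO THE DEFINED FUNCTIONAL WITH THE CONCRETE READING** — hypothesis list = the END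
of record's MINUS `h0 ∕ hfac ∕ hreprV ∕ hρ ∕ hboxOn` (PROVED here), `hbase` on the scale-0 datum, `+ hwt`; `hAdm ∕ hCup ∕ hKP` speak of
the defined functional `EfOf …` and of the readings `admOf …` of ITS arising box tables.  Conclusion the END of record's, letter
for letter. [cite: Balaban1987RG1, (0.23) p.256, (0.28)-(0.29) p.258, (1.3) p.260, (1.18) p.263, (1.20)-(1.22) p.264, (2.13)-(2.14) p.268; Balaban1988RG2Cluster, (1.23)-(1.29) pp.7-8, (1.33)-(1.36) p.9, (2.14)-(2.15) p.15] -/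
theorem termSize_ne9_and_fadingMemory_endApplied [Nonempty ι] (G : ClusterGeom (doubleCarriers C₀))
    {D : CurData C₀ E ι α β γ δ} {K : KerData C₀ E ι α' β' γ' δ' Pt}
    {ℓg ℓk gain : ℕ → ℕ → ℝ} {cdir cK δ₀ δ₁ w w0 c0 c1 d0 O1 cQa cQb : ℝ} {W : Set (ℕ → ℝ)}
    {Adm MF : Set (E → (doubleCarriers C₀).Dom → ℝ)}
    {r : ℕ → (E → (doubleCarriers C₀).Dom → ℝ) → ℝ} {A : E → (doubleCarriers C₀).Dom → ℝ}
    {act : ℕ → ℝ → E → lp (fun _ : ι => ℂ) ∞ → G.P → ℂ}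
    {n : ℕ → ℝ → E → G.P → ℝ} {lip clip : ℕ → ℝ} {a d : G.P → ℝ} {δv : (doubleCarriers C₀).Dom → ℝ}
    {κ B lipbar clipbar qTbar ω cr aA Nbar clipa lam : ℝ} {p₀ N : ℕ → ℝ}
    -- species (a)
    (hD : D.Admissible ℓg cdir d0) (hℓ : ∀ k j, 0 < ℓg k j)
    (hLa : LevelCountsG D.toC.frame κ D.κ₁ O1 cQa (fun k j => ℓg k j ^ 5) (agePow ω))
    (hAa : PieceAdditiveOn (analyticClass D.R) D.toC)
    (hclipa : 0 ≤ clipa) (hcdir : 0 < cdir) (hhalf : ∀ k j, cdir * ℓg k j < 1 / 2)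
    (hcont : ∀ (k : ℕ) (s : ℕ → ℝ) (y : ι) (a : α) (b : β) (x : (doubleCarriers C₀).Dom),
      ContinuousOn (fun q : (ℂ × ((δ → ℝ) × (δ → ℂ))) × ℂ => D.cur k s y a b x q.1.1 q.1.2.1 q.1.2.2 q.2)
        ((sphere (0:ℂ) (D.r k) ×ˢ {q | OnContour D.κ₁ (D.cubes k y a b) q.1 q.2}) ×ˢ sphere (0:ℂ) 1))
    (hlip : ∀ g ∈ W, ∀ g' ∈ W, ∀ (k : ℕ) (y : ι), ∀ a ∈ D.S0 k y, ∀ b ∈ D.SY k y a, ∀ (j : ℕ), ∀ x ∈ D.src k y a j,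
      ∀ t ∈ sphere (0:ℂ) (D.r k), ∀ (s' : δ → ℝ) (σ' : δ → ℂ), OnContour D.κ₁ (D.cubes k y a b) s' σ' →
        ∀ τ ∈ ball (0:ℂ) (1 / (2 * (cdir * ℓg k j))),
          ‖D.cur k g y a b x t s' σ' τ - D.cur k g' y a b x t s' σ' τ‖ ≤ clipa * (D.R x.1 / 2) * |g k - g' k|)
    (hroom : ∀ g ∈ W, ∀ (k : ℕ) (y : ι), ∀ a ∈ D.S0 k y, ∀ b ∈ D.SY k y a, ∀ (j : ℕ), ∀ x ∈ D.src k y a j,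
      ∀ t ∈ sphere (0:ℂ) (D.r k), ∀ (s' : δ → ℝ) (σ' : δ → ℂ), OnContour D.κ₁ (D.cubes k y a b) s' σ' →
        ∀ τ ∈ ball (0:ℂ) (1 / (2 * (cdir * ℓg k j))), ‖D.cur k g y a b x t s' σ' τ‖ ≤ D.R x.1 / 2)
    -- species (b)
    (hK : K.Admissible ℓk gain cK δ₀ δ₁ w w0 c0 c1 d0) (hκ₁ : K.κ₁ = D.κ₁) (hR : K.R = D.R)
    (hdY : K.toC.frame.dY = D.toC.frame.dY)
    (hLb : LevelCountsG K.toC.frame (κ - w) K.κ₁ O1 cQb gain (agePow ω))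
    (hAb : PieceAdditiveOn (analyticClass K.R) K.toC) (hlam : 0 ≤ lam)
    (hkerC : ∀ (k : ℕ) (s : ℕ → ℝ) (y : ι) (a : α') (b : β') (x : (doubleCarriers C₀).Dom), ∀ p ∈ K.pts k y a,
      ∀ q ∈ K.pts k y a, ∀ F : E → ℂ, DifferentiableOn ℂ F (ball 0 (K.R x.1)) →
        Continuous fun wv : ℂ × (δ' → ℝ) × (δ' → ℂ) => K.ker k s y a b x wv.1 wv.2.1 wv.2.2 p q F)
    (hkerL : ∀ g ∈ W, ∀ g' ∈ W, ∀ (k : ℕ) (y : ι), ∀ a ∈ K.S0 k y, ∀ b ∈ K.SY k y a, ∀ (j : ℕ), ∀ x ∈ K.src k y a j,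
      ∀ t ∈ sphere (0:ℂ) (K.r k), ∀ (s' : δ' → ℝ) (σ' : δ' → ℂ), OnContour K.κ₁ (K.cubes k y a b) s' σ' →
        ∀ p ∈ K.pts k y a, ∀ q ∈ K.pts k y a, ∀ (F : E → ℂ) (M : ℝ),
          DifferentiableOn ℂ F (ball 0 (K.R x.1)) → (∀ z ∈ ball (0:E) (K.R x.1), ‖F z‖ ≤ M) →
            ‖K.ker k g y a b x t s' σ' p q F - K.ker k g' y a b x t s' σ' p q F‖ ≤
              cK * lam * M * gain k j * K.ρd p q ^ K.m * Real.exp (-(δ₀ * (K.dX x.1 p + K.dX x.1 q))) * |g k - g' k|)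
    (hO1 : 0 ≤ O1) (hcQa : 0 ≤ cQa) (hcQb : 0 ≤ cQb) (hMF : MF ⊆ analyticClass D.R)
    -- the face's binders (END-M `…_margProj`), at 𝒯 := cpieceChannel D.toC + cpieceChannel K.toC — minus `hTcup` ∕ `hqT0`
    (U₀ : E) (explZ : ℕ → E → (doubleCarriers C₀).Dom → ℝ) (base : E → (doubleCarriers C₀).Dom → ℝ)
    (hAdm : AdmissibleTerms (EfOf G act (weightOf D.toC.frame D.κ₁ d0 O1 (D.Kp cdir + K.Kp cK w0 c0 c1)) U₀ explZ base (cpieceChannel D.toC + cpieceChannel K.toC) (margProj r A)) W Adm) (hres : AdmRestrict Adm)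
    (hrA : ReadAdditive Adm r) (hr0 : ReadZero r) (hrs : ReadSize Adm r κ cr) (hA : DirSize A κ aA) (hcr : 0 ≤ cr)
    (haA : 0 ≤ aA) (hPinto : ProjInto Adm MF (margProj r A))
    (hclip0 : ∀ k, 0 ≤ clip k)
    (hCup : ∀ g ∈ W, ∀ g' ∈ W, ∀ (k : ℕ) (U : E) (X : (doubleCarriers C₀).Dom), (doubleCarriers C₀).scale X = k + 1 →
      ∀ Q ∈ admOf G act (weightOf D.toC.frame D.κ₁ d0 O1 (D.Kp cdir + K.Kp cK w0 c0 c1)) U₀ explZ base (cpieceChannel D.toC + cpieceChannel K.toC) (margProj r A) W (fun k => sizeRadius (fun k j => (1 + cr * aA) * (tauOfG cQa (agePow ω) + tauOfG cQb (agePow ω)) k j) N k) k, ∀ γ' ∈ G.vol X,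
      ‖act k (g k) U Q γ'‖ ≤ n k (g' k) U γ' ∧
        ‖act k (g k) U Q γ' - act k (g' k) U Q γ'‖ ≤ clip k * |g k - g' k| * n k (g' k) U γ')
    (hclipb : ∀ k, clip k ≤ clipbar) (hNb : ∀ j, N j ≤ Nbar)
    (hqTb : (64 * clipa * cQa + lam * cQb) * ((1 + cr * aA) * Nbar) * (1 - ω)⁻¹ ≤ qTbar)
    (hKP : TwoPointKP G W act (admOf G act (weightOf D.toC.frame D.κ₁ d0 O1 (D.Kp cdir + K.Kp cK w0 c0 c1)) U₀ explZ base (cpieceChannel D.toC + cpieceChannel K.toC) (margProj r A) W (fun k => sizeRadius (fun k j => (1 + cr * aA) * (tauOfG cQa (agePow ω) + tauOfG cQb (agePow ω)) k j) N k)) n lip a d) (hdec : G.DecayExtract δv d) (hpin : G.PinBudget a δv (fun _ => B) κ)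
    (hwt : ∀ k y, 0 < weightOf D.toC.frame D.κ₁ d0 O1 (D.Kp cdir + K.Kp cK w0 c0 c1) k y)
    (hexplZ : ∀ (k : ℕ) (U : E) (X : (doubleCarriers C₀).Dom), (doubleCarriers C₀).scale X = k + 1 →
      |explZ k U X| ≤ Real.exp (-(κ * (doubleCarriers C₀).d X)) * p₀ k)
    (hbase0 : ∀ (U : E) (X : (doubleCarriers C₀).Dom), (doubleCarriers C₀).scale X = 0 →
      |base U X| ≤ Real.exp (-(κ * (doubleCarriers C₀).d X)) * N 0)
    (hNsucc : ∀ j, p₀ j + 2 * B ≤ N (j + 1)) (hNnn : ∀ j, 0 ≤ N j)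
    (hB : 0 ≤ B) (hlipb : ∀ k, lip k ≤ lipbar) (hω : 0 ≤ ω) (hω1 : ω < 1)
    (hpos : 0 < ω + 8 * lipbar * B * ((1 + cr * aA) * (cQa + cQb))) :
    TermSize (EfOf G act (weightOf D.toC.frame D.κ₁ d0 O1 (D.Kp cdir + K.Kp cK w0 c0 c1)) U₀ explZ base (cpieceChannel D.toC + cpieceChannel K.toC) (margProj r A)) W κ N ∧
      NE9 (EfOf G act (weightOf D.toC.frame D.κ₁ d0 O1 (D.Kp cdir + K.Kp cK w0 c0 c1)) U₀ explZ base (cpieceChannel D.toC + cpieceChannel K.toC) (margProj r A)) W κ (prodModuli (8 * clipbar * B + 8 * lipbar * B * qTbar)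
        fun _ => ω + 8 * lipbar * B * ((1 + cr * aA) * (cQa + cQb))) ∧
        FadingMemory ((8 * clipbar * B + 8 * lipbar * B * qTbar) / (ω + 8 * lipbar * B * ((1 + cr * aA) * (cQa + cQb))))
          (ω + 8 * lipbar * B * ((1 + cr * aA) * (cQa + cQb)))
          (prodModuli (8 * clipbar * B + 8 * lipbar * B * qTbar)
            fun _ => ω + 8 * lipbar * B * ((1 + cr * aA) * (cQa + cQb))) := by
  have hloc : ChannelLocal MF (cpieceChannel D.toC + cpieceChannel K.toC) :=
    channelLocal_add (structureBinders_cur hD MF).1 (structureBinders_ker hK MF).1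
  have hfac := factorises_EfOf G act (weightOf D.toC.frame D.κ₁ d0 O1 (D.Kp cdir + K.Kp cK w0 c0 c1)) U₀ explZ base
    (channelLocal_compProj_margProj hr0 hPinto hloc) hAdm.1
  exact termSize_ne9_and_fadingMemory_species_margProj_fedA3_on G hD hℓ hLa hAa hclipa hcdir hhalf hcont hlip hroom hK hκ₁ hR
    hdY hLb hAb hlam hkerC hkerL hO1 hcQa hcQb hMF
    (readingρ (weightOf D.toC.frame D.κ₁ d0 O1 (D.Kp cdir + K.Kp cK w0 c0 c1))) U₀ explZ (scaleZeroFree_recE W) hAdm hres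
    hrA hr0 hrs hA hcr haA hPinto hfac hclip0 hCup (fun _ _ _ _ _ => rfl) hclipb hNb hqTb hKP hdec hpin (hρ_reading hwt) hexplZ
    (fun g _ U X hX => by rw [EfOf_zero]; exacts [hbase0 U X hX, hX]) hNsucc hNnn
    (fun k g hg g' hg' hb => ⟨g, hg, g', hg', hb, rfl⟩) hB hlipb hω hω1 hpos

end Species

end Summit.QuantumFields.BalabanUV.T4Continuum.NE9EndApplied

end
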